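import Summits.NavierStokesRegularity.NavierStokesRegularity.Theorems.EfficiencyFloorRigidExitLadder
import Summits.NavierStokesRegularity.NavierStokesRegularity.Theorems.EfficiencyFloorNearSaturationNearMaximiserSeqCoreCompactness
import HarnessLib

/-!
# Route `EfficiencyFloor`, rung `LerayFloorGap` (stmt-25164) of the `ProductionEfficiencyDecay` ladder (stmt-22866):
# the rung BY NAME from CONCENTRATION-COMPACTNESS of the Lu–Doering extremal problem + clause (a) of `MaximiserSetRigidity`

By-name helper file (`--supports stmt-NavierStokesRegularity-22866`). State of rung one after this hand: the landed ladder
`lerayFloorGap_of_nearSaturation_of_partA` (p840570: `LerayFloorGap ⟸ NearSaturationNearMaximiser + clause (a)`) composed with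
`nearSaturationNearMaximiser_of_compact` (`…SeqCoreCompactness`: stmt-25482 ⟸ precompactness modulo translations of
normalised maximising sequences of `S/(Z^{3/4}Pal^{3/4})`). Hence:

* `lerayFloorGap_of_compact_of_maximiserSetRigidity` — COMPACTNESS (at the sharp constant) + `MaximiserSetRigidity` ⟹
  `LerayFloorGap`;
* `lerayFloorGap_of_compact_of_partA` — COMPACTNESS + clause (a) of `MaximiserSetRigidity` (finitely many normalised-maximiser
  orbits) ⟹ `LerayFloorGap`.

READING (repair census of the rung, exact): rung one `LerayFloorGap` ⟸ (i) the concentration-compactness theorem for the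
Lu–Doering functional on `ℝ³` [XL; vanishing excluded by `EfficiencyConcentration` stmt-23111, dichotomy penalty landed,
sequential bookkeeping and continuity of `Z, Pal, S` landed this hand] + (ii) clause (a) of `MaximiserSetRigidity` (stmt-25512)
[bet]. HONEST FRAMING: a composition of reductions over OPEN hypotheses; `LerayFloorGap`, stmt-25482, stmt-25512,
`ProductionEfficiencyDecay` (stmt-22866) and Navier–Stokes regularity stay OPEN; no summit statement is proved. [folklore]
-/

-- the problem directory repeats the summit name (`NavierStokesRegularity/NavierStokesRegularity`)
set_option linter.dupNamespace false

noncomputable section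

namespace Summit.NavierStokesRegularity.NavierStokesRegularity.Theorems

namespace NearSaturationNearMaximiser

namespace SeqCore

open Set MeasureTheory Filter Topology Function
open scoped InnerProductSpace ENNReal
open Literature.Analysis.FluidPDE

/-- **`LerayFloorGap` ⟸ COMPACTNESS + `MaximiserSetRigidity`**, BY NAME. [folklore] -/
theorem lerayFloorGap_of_compact_of_maximiserSetRigidity
    (HC : ∀ c : ℝ, (0 < c ∧ (∀ v : EuclideanSpace ℝ (Fin 3) → EuclideanSpace ℝ (Fin 3), (ContDiff ℝ (⊤ : ℕ∞) v ∧
      Literature.Analysis.FluidPDE.VectorCalculus.IsDivFree v ∧ (∫⁻ x, ‖iteratedFDeriv ℝ 0 v x‖ₑ ^ 2 < ⊤) ∧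
      (∫⁻ x, ‖iteratedFDeriv ℝ 1 v x‖ₑ ^ 2 < ⊤) ∧ (∫⁻ x, ‖iteratedFDeriv ℝ 2 v x‖ₑ ^ 2 < ⊤)) → (∫ x,
      ⟪Literature.Analysis.FluidPDE.curl v x, fderiv ℝ v x (Literature.Analysis.FluidPDE.curl v x)⟫_ℝ) ≤ c *
      (∫ x, ‖Literature.Analysis.FluidPDE.curl v x‖ ^ 2) ^ (3 / 4 : ℝ) * (∫ x,
      Literature.Analysis.FluidPDE.frobeniusNormSq (fderiv ℝ (Literature.Analysis.FluidPDE.curl v) x)) ^ (3 /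
      4 : ℝ)) ∧ ∀ c' : ℝ, (∀ w : EuclideanSpace ℝ (Fin 3) → EuclideanSpace ℝ (Fin 3), (ContDiff ℝ (⊤ : ℕ∞) w ∧
      Literature.Analysis.FluidPDE.VectorCalculus.IsDivFree w ∧ (∫⁻ x, ‖iteratedFDeriv ℝ 0 w x‖ₑ ^ 2 < ⊤) ∧
      (∫⁻ x, ‖iteratedFDeriv ℝ 1 w x‖ₑ ^ 2 < ⊤) ∧ (∫⁻ x, ‖iteratedFDeriv ℝ 2 w x‖ₑ ^ 2 < ⊤)) → (∫ x,
      ⟪Literature.Analysis.FluidPDE.curl w x, fderiv ℝ w x (Literature.Analysis.FluidPDE.curl w x)⟫_ℝ) ≤ c' *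
      (∫ x, ‖Literature.Analysis.FluidPDE.curl w x‖ ^ 2) ^ (3 / 4 : ℝ) * (∫ x,
      Literature.Analysis.FluidPDE.frobeniusNormSq (fderiv ℝ (Literature.Analysis.FluidPDE.curl w) x)) ^ (3 /
      4 : ℝ)) → c ≤ c') →
      ∀ v : ℕ → EuclideanSpace ℝ (Fin 3) → EuclideanSpace ℝ (Fin 3), (∀ n, ContDiff ℝ (⊤ : ℕ∞) (v n) ∧
      Literature.Analysis.FluidPDE.VectorCalculus.IsDivFree (v n) ∧ (∫⁻ x, ‖iteratedFDeriv ℝ 0 (v n) x‖ₑ ^ 2 < ⊤) ∧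
      (∫⁻ x, ‖iteratedFDeriv ℝ 1 (v n) x‖ₑ ^ 2 < ⊤) ∧ (∫⁻ x, ‖iteratedFDeriv ℝ 2 (v n) x‖ₑ ^ 2 < ⊤)) →
      (∀ n, (∫ x, ‖Literature.Analysis.FluidPDE.curl (v n) x‖ ^ 2) = 1) →
      (∀ n, (∫ x, Literature.Analysis.FluidPDE.frobeniusNormSq (fderiv ℝ (Literature.Analysis.FluidPDE.curl (v n)) x)) = 1) →
      Tendsto (fun n => ∫ x, ⟪Literature.Analysis.FluidPDE.curl (v n) x, fderiv ℝ (v n) x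
        (Literature.Analysis.FluidPDE.curl (v n) x)⟫_ℝ) atTop (𝓝 c) →
      ∃ w : EuclideanSpace ℝ (Fin 3) → EuclideanSpace ℝ (Fin 3), (ContDiff ℝ (⊤ : ℕ∞) w ∧
        Literature.Analysis.FluidPDE.VectorCalculus.IsDivFree w ∧ (∫⁻ x, ‖iteratedFDeriv ℝ 0 w x‖ₑ ^ 2 < ⊤) ∧
        (∫⁻ x, ‖iteratedFDeriv ℝ 1 w x‖ₑ ^ 2 < ⊤) ∧ (∫⁻ x, ‖iteratedFDeriv ℝ 2 w x‖ₑ ^ 2 < ⊤)) ∧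
        ∃ (a : ℕ → EuclideanSpace ℝ (Fin 3)) (φ : ℕ → ℕ), StrictMono φ ∧
        Tendsto (fun k => ∫ x, ‖Literature.Analysis.FluidPDE.curl ((fun x => v (φ k) (x - a k)) - w) x‖ ^ 2) atTop (𝓝 0) ∧
        Tendsto (fun k => ∫ x, Literature.Analysis.FluidPDE.frobeniusNormSq (fderiv ℝ
          (Literature.Analysis.FluidPDE.curl ((fun x => v (φ k) (x - a k)) - w)) x)) atTop (𝓝 0))
    (hM : Summit.NavierStokesRegularity.NavierStokesRegularity.Theses.EfficiencyFloor.MaximiserSetRigidity) :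
    Summit.NavierStokesRegularity.NavierStokesRegularity.Theses.EfficiencyFloor.LerayFloorGap :=
  RigidExit.Ladder.lerayFloorGap_of_nearSaturation_of_maximiserSetRigidity (nearSaturationNearMaximiser_of_compact HC) hM

/-- **`LerayFloorGap` ⟸ COMPACTNESS + clause (a) of `MaximiserSetRigidity`**, BY NAME — the exact open content of rung one of
the floor-constant ladder after this hand. [folklore] -/
theorem lerayFloorGap_of_compact_of_partA
    (HC : ∀ c : ℝ, (0 < c ∧ (∀ v : EuclideanSpace ℝ (Fin 3) → EuclideanSpace ℝ (Fin 3), (ContDiff ℝ (⊤ : ℕ∞) v ∧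
      Literature.Analysis.FluidPDE.VectorCalculus.IsDivFree v ∧ (∫⁻ x, ‖iteratedFDeriv ℝ 0 v x‖ₑ ^ 2 < ⊤) ∧
      (∫⁻ x, ‖iteratedFDeriv ℝ 1 v x‖ₑ ^ 2 < ⊤) ∧ (∫⁻ x, ‖iteratedFDeriv ℝ 2 v x‖ₑ ^ 2 < ⊤)) → (∫ x,
      ⟪Literature.Analysis.FluidPDE.curl v x, fderiv ℝ v x (Literature.Analysis.FluidPDE.curl v x)⟫_ℝ) ≤ c *
      (∫ x, ‖Literature.Analysis.FluidPDE.curl v x‖ ^ 2) ^ (3 / 4 : ℝ) * (∫ x,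
      Literature.Analysis.FluidPDE.frobeniusNormSq (fderiv ℝ (Literature.Analysis.FluidPDE.curl v) x)) ^ (3 /
      4 : ℝ)) ∧ ∀ c' : ℝ, (∀ w : EuclideanSpace ℝ (Fin 3) → EuclideanSpace ℝ (Fin 3), (ContDiff ℝ (⊤ : ℕ∞) w ∧
      Literature.Analysis.FluidPDE.VectorCalculus.IsDivFree w ∧ (∫⁻ x, ‖iteratedFDeriv ℝ 0 w x‖ₑ ^ 2 < ⊤) ∧
      (∫⁻ x, ‖iteratedFDeriv ℝ 1 w x‖ₑ ^ 2 < ⊤) ∧ (∫⁻ x, ‖iteratedFDeriv ℝ 2 w x‖ₑ ^ 2 < ⊤)) → (∫ x,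
      ⟪Literature.Analysis.FluidPDE.curl w x, fderiv ℝ w x (Literature.Analysis.FluidPDE.curl w x)⟫_ℝ) ≤ c' *
      (∫ x, ‖Literature.Analysis.FluidPDE.curl w x‖ ^ 2) ^ (3 / 4 : ℝ) * (∫ x,
      Literature.Analysis.FluidPDE.frobeniusNormSq (fderiv ℝ (Literature.Analysis.FluidPDE.curl w) x)) ^ (3 /
      4 : ℝ)) → c ≤ c') →
      ∀ v : ℕ → EuclideanSpace ℝ (Fin 3) → EuclideanSpace ℝ (Fin 3), (∀ n, ContDiff ℝ (⊤ : ℕ∞) (v n) ∧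
      Literature.Analysis.FluidPDE.VectorCalculus.IsDivFree (v n) ∧ (∫⁻ x, ‖iteratedFDeriv ℝ 0 (v n) x‖ₑ ^ 2 < ⊤) ∧
      (∫⁻ x, ‖iteratedFDeriv ℝ 1 (v n) x‖ₑ ^ 2 < ⊤) ∧ (∫⁻ x, ‖iteratedFDeriv ℝ 2 (v n) x‖ₑ ^ 2 < ⊤)) →
      (∀ n, (∫ x, ‖Literature.Analysis.FluidPDE.curl (v n) x‖ ^ 2) = 1) →
      (∀ n, (∫ x, Literature.Analysis.FluidPDE.frobeniusNormSq (fderiv ℝ (Literature.Analysis.FluidPDE.curl (v n)) x)) = 1) →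
      Tendsto (fun n => ∫ x, ⟪Literature.Analysis.FluidPDE.curl (v n) x, fderiv ℝ (v n) x
        (Literature.Analysis.FluidPDE.curl (v n) x)⟫_ℝ) atTop (𝓝 c) →
      ∃ w : EuclideanSpace ℝ (Fin 3) → EuclideanSpace ℝ (Fin 3), (ContDiff ℝ (⊤ : ℕ∞) w ∧
        Literature.Analysis.FluidPDE.VectorCalculus.IsDivFree w ∧ (∫⁻ x, ‖iteratedFDeriv ℝ 0 w x‖ₑ ^ 2 < ⊤) ∧
        (∫⁻ x, ‖iteratedFDeriv ℝ 1 w x‖ₑ ^ 2 < ⊤) ∧ (∫⁻ x, ‖iteratedFDeriv ℝ 2 w x‖ₑ ^ 2 < ⊤)) ∧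
        ∃ (a : ℕ → EuclideanSpace ℝ (Fin 3)) (φ : ℕ → ℕ), StrictMono φ ∧
        Tendsto (fun k => ∫ x, ‖Literature.Analysis.FluidPDE.curl ((fun x => v (φ k) (x - a k)) - w) x‖ ^ 2) atTop (𝓝 0) ∧
        Tendsto (fun k => ∫ x, Literature.Analysis.FluidPDE.frobeniusNormSq (fderiv ℝ
          (Literature.Analysis.FluidPDE.curl ((fun x => v (φ k) (x - a k)) - w)) x)) atTop (𝓝 0))
    (hA : ∀ c ν : ℝ, (0 < c ∧ (∀ v : EuclideanSpace ℝ (Fin 3) → EuclideanSpace ℝ (Fin 3), (ContDiff ℝ (⊤ : ℕ∞) v ∧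
      Literature.Analysis.FluidPDE.VectorCalculus.IsDivFree v ∧ (∫⁻ x, ‖iteratedFDeriv ℝ 0 v x‖ₑ ^ 2 < ⊤) ∧
      (∫⁻ x, ‖iteratedFDeriv ℝ 1 v x‖ₑ ^ 2 < ⊤) ∧ (∫⁻ x, ‖iteratedFDeriv ℝ 2 v x‖ₑ ^ 2 < ⊤)) → (∫ x,
      ⟪Literature.Analysis.FluidPDE.curl v x, fderiv ℝ v x (Literature.Analysis.FluidPDE.curl v x)⟫_ℝ) ≤ c *
      (∫ x, ‖Literature.Analysis.FluidPDE.curl v x‖ ^ 2) ^ (3 / 4 : ℝ) * (∫ x,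
      Literature.Analysis.FluidPDE.frobeniusNormSq (fderiv ℝ (Literature.Analysis.FluidPDE.curl v) x)) ^ (3 / 4
      : ℝ)) ∧ ∀ c' : ℝ, (∀ w : EuclideanSpace ℝ (Fin 3) → EuclideanSpace ℝ (Fin 3), (ContDiff ℝ (⊤ : ℕ∞) w ∧
      Literature.Analysis.FluidPDE.VectorCalculus.IsDivFree w ∧ (∫⁻ x, ‖iteratedFDeriv ℝ 0 w x‖ₑ ^ 2 < ⊤) ∧
      (∫⁻ x, ‖iteratedFDeriv ℝ 1 w x‖ₑ ^ 2 < ⊤) ∧ (∫⁻ x, ‖iteratedFDeriv ℝ 2 w x‖ₑ ^ 2 < ⊤)) → (∫ x,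
      ⟪Literature.Analysis.FluidPDE.curl w x, fderiv ℝ w x (Literature.Analysis.FluidPDE.curl w x)⟫_ℝ) ≤ c' *
      (∫ x, ‖Literature.Analysis.FluidPDE.curl w x‖ ^ 2) ^ (3 / 4 : ℝ) * (∫ x,
      Literature.Analysis.FluidPDE.frobeniusNormSq (fderiv ℝ (Literature.Analysis.FluidPDE.curl w) x)) ^ (3 / 4
      : ℝ)) → c ≤ c') → 0 < ν → ∃ (k : ℕ) (ms : Fin k → EuclideanSpace ℝ (Fin 3) → EuclideanSpace ℝ (Fin 3)), (∀
      i, ((ContDiff ℝ (⊤ : ℕ∞) (ms i) ∧ Literature.Analysis.FluidPDE.VectorCalculus.IsDivFree (ms i) ∧ (∫⁻ x,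
      ‖iteratedFDeriv ℝ 0 (ms i) x‖ₑ ^ 2 < ⊤) ∧ (∫⁻ x, ‖iteratedFDeriv ℝ 1 (ms i) x‖ₑ ^ 2 < ⊤) ∧ (∫⁻ x,
      ‖iteratedFDeriv ℝ 2 (ms i) x‖ₑ ^ 2 < ⊤)) ∧ 0 < (∫ x, ‖Literature.Analysis.FluidPDE.curl (ms i) x‖ ^ 2) ∧
      (∫ x, ⟪Literature.Analysis.FluidPDE.curl (ms i) x, fderiv ℝ (ms i) x (Literature.Analysis.FluidPDE.curl
      (ms i) x)⟫_ℝ) = c * (∫ x, ‖Literature.Analysis.FluidPDE.curl (ms i) x‖ ^ 2) ^ (3 / 4 : ℝ) * (∫ x,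
      Literature.Analysis.FluidPDE.frobeniusNormSq (fderiv ℝ (Literature.Analysis.FluidPDE.curl (ms i)) x)) ^
      (3 / 4 : ℝ) ∧ (∫ x, Literature.Analysis.FluidPDE.frobeniusNormSq (fderiv ℝ
      (Literature.Analysis.FluidPDE.curl (ms i)) x)) = 81 * c ^ 4 / (256 * ν ^ 4) * (∫ x,
      ‖Literature.Analysis.FluidPDE.curl (ms i) x‖ ^ 2) ^ 3)) ∧ ∀ m : EuclideanSpace ℝ (Fin 3) → EuclideanSpace
      ℝ (Fin 3), ((ContDiff ℝ (⊤ : ℕ∞) m ∧ Literature.Analysis.FluidPDE.VectorCalculus.IsDivFree m ∧ (∫⁻ x,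
      ‖iteratedFDeriv ℝ 0 m x‖ₑ ^ 2 < ⊤) ∧ (∫⁻ x, ‖iteratedFDeriv ℝ 1 m x‖ₑ ^ 2 < ⊤) ∧ (∫⁻ x, ‖iteratedFDeriv
      ℝ 2 m x‖ₑ ^ 2 < ⊤)) ∧ 0 < (∫ x, ‖Literature.Analysis.FluidPDE.curl m x‖ ^ 2) ∧ (∫ x,
      ⟪Literature.Analysis.FluidPDE.curl m x, fderiv ℝ m x (Literature.Analysis.FluidPDE.curl m x)⟫_ℝ) = c *
      (∫ x, ‖Literature.Analysis.FluidPDE.curl m x‖ ^ 2) ^ (3 / 4 : ℝ) * (∫ x,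
      Literature.Analysis.FluidPDE.frobeniusNormSq (fderiv ℝ (Literature.Analysis.FluidPDE.curl m) x)) ^ (3 / 4
      : ℝ) ∧ (∫ x, Literature.Analysis.FluidPDE.frobeniusNormSq (fderiv ℝ (Literature.Analysis.FluidPDE.curl m)
      x)) = 81 * c ^ 4 / (256 * ν ^ 4) * (∫ x, ‖Literature.Analysis.FluidPDE.curl m x‖ ^ 2) ^ 3) → (∃ (i : Fin
      k) (a : EuclideanSpace ℝ (Fin 3)) (R : EuclideanSpace ℝ (Fin 3) ≃ₗᵢ[ℝ] EuclideanSpace ℝ (Fin 3)) (l : ℝ),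
      0 < l ∧ m = fun x => l • R (ms i (l • R.symm (x - a))))) :
    Summit.NavierStokesRegularity.NavierStokesRegularity.Theses.EfficiencyFloor.LerayFloorGap :=
  RigidExit.Ladder.lerayFloorGap_of_nearSaturation_of_partA (nearSaturationNearMaximiser_of_compact HC) hA

end SeqCore

end NearSaturationNearMaximiser

end Summit.NavierStokesRegularity.NavierStokesRegularity.Theorems

end
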